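import Literature.Computability.MetaComplexity.GapMINKTviaNW
import Literature.Computability.Complexity.CodeFPBudgets
import Literature.Computability.Complexity.CodeFPStrings
import Literature.Computability.Complexity.PrefixFunctions
import HarnessLib

/-!
# Hirahara 2018, Thm. 4.7 in advice form suffices: from a decoder with `O(log(n/ε))` bits of advice
# to the list decoder consumed by `Hirahara2018_gapMINKT_mem_PromiseP_of_code`

Topic `Literature/Computability/MetaComplexity`, companion of `GapMINKTviaNW.lean` (the decision
route to Hirahara's Cor. 4.23: `Hirahara2018_gapMINKT_mem_PromiseP_of_code (hBPP) (hcode)` with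
`hcode` a polynomial-time list-decodable binary code in LIST form — the decoder prints a coded list
whose `i`-th field, `i ≤ p_L(n + e)`, is the message) and of `ListDecodableCode.lean` (the code of
Thm. 4.7 — S. Hirahara, *Non-black-box worst-case to average-case reductions within NP*, FOCS 2018 /
ECCC TR18-138, Thm. 4.7: "`Enc_{n,ε}` and its list decoder `Dec_{n,ε}` are computable in time
`poly(n, 1/ε)`" — vendored there in ADVICE form: "`x` is the `i`-th element of the list" becomes
"some `O(log(n/ε))`-bit string makes the deterministic polynomial-time decoder output exactly `x`").
The two forms are equivalent by enumerating the advice; this file proves the direction the decision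
route needs:

* `CodeAdv.advList L` — all bit strings of length `≤ L`, by length and then by value
  (`mem_advList`, `length_advList_le`: `≤ 4^L`);
* `CodeAdv.decList decA cA` — the list decoder: on `⟨1ᵉ, ⟨1ⁿ, r⟩⟩` run the advised decoder `decA`
  on `⟨adv, ⟨1ᵉ, ⟨1ⁿ, r⟩⟩⟩` for every `adv` of length `≤ c_A (⌊log₂(n+e)⌋ + 1)` and print the coded
  list of the outputs; `decList_codeFP` (typed `FP` algebra: the budget list `((n+e+1) · 2)^{c_A}`
  bounds every `2^m`, `m ≤ L`; fixed-width numerals `natBits m i` by `padTakeFn`,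
  `takeD_eq_natBits`);
* **`hcode_of_advice`** — if `enc, decA ∈ FP`, `|Enc(1ᵉ, x)| = 2^{ℓ(n,e)}`, `ℓ ≤ c_L(log₂(n+e)+1)`,
  and every received word of agreement `≥ (1/2 + 1/e) 2^ℓ` with `Enc(1ᵉ, x)` is decoded to `x` under
  SOME advice of length `≤ c_A(log₂(n+e)+1)`, then the hypothesis `hcode` of
  `Hirahara2018_gapMINKT_mem_PromiseP_of_code` holds (list size `p_L = 4^{c_A} (X + 1)^{2 c_A}`);
* **`Hirahara2018_gapMINKT_mem_PromiseP_of_adviceCode`** — Cor. 4.23 from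
  `BuhrmanFortnowPavan2004_PromiseBPP'_subset_PromiseP` and such an advice-form code.

Everything is proved; the definitions are the enumeration and the decoder brick. No named fact is
introduced (D-0026). The advice format `⟨adv, ⟨1ᵉ, ⟨1ⁿ, r⟩⟩⟩` is a convention of this file; a decoder
reading another packing is composed with an `FP` re-packing map first.

## References

* S. Hirahara, *Non-black-box worst-case to average-case reductions within NP*, FOCS 2018, 247–258;
  full version ECCC TR18-138 rev. 1, Thm. 4.7, Cor. 4.8 (the advice form: "`K_{t'}(x) ≤ K_{t,ε}(Enc(x)) +
  O(log(n/ε))`"), Cor. 4.23 [Hirahara2018].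
* M. Sudan, *Decoding of Reed Solomon codes beyond the error-correction bound*, J. Complexity 13 (1997).
* S. Arora, B. Barak, *Computational Complexity: A Modern Approach*, CUP 2009, §1.3 (bounded loops),
  §19.3–19.4 [AroraBarakCC2009].
-/

noncomputable section

namespace Literature.Computability.MetaComplexity

open _root_.Computability Polynomial Complexity Complexity.Brick Complexity.Plumb Complexity.CodeFP

namespace CodeAdv

/-! ### All strings of bounded length -/

/-- **All bit strings of length `≤ L`**, by length `m = 0, …, L` and, within a length, by value
`i < 2^m` (fixed-width little-endian numerals `natBits m i`). [folklore] -/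
def advList (L : ℕ) : List (List Bool) :=
  ((List.range (L + 1)).map fun m => (List.range (2 ^ m)).map (natBits m)).flatten

/-- Every string of length `≤ L` is listed. [folklore] -/
theorem mem_advList {L : ℕ} {s : List Bool} (hs : s.length ≤ L) : s ∈ advList L := by
  refine List.mem_flatten.2 ⟨(List.range (2 ^ s.length)).map (natBits s.length),
    List.mem_map.2 ⟨s.length, List.mem_range.2 (by omega), rfl⟩, ?_⟩
  exact List.mem_map.2 ⟨bitsToNat s, List.mem_range.2 (bitsToNat_lt s), CoinEnum.natBits_bitsToNat s⟩

/-- The list has at most `4^L` entries (`∑_{m ≤ L} 2^m ≤ (L+1) 2^L ≤ 4^L`). [folklore] -/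
theorem length_advList_le (L : ℕ) : (advList L).length ≤ 4 ^ L := by
  unfold advList
  rw [List.length_flatten, List.map_map]
  have h : ∀ m ∈ List.range (L + 1), (List.length ∘ fun m => (List.range (2 ^ m)).map (natBits m)) m ≤ 2 ^ L := by
    intro m hm
    simp only [Function.comp_apply, List.length_map, List.length_range]
    exact Nat.pow_le_pow_right two_pos (by have := List.mem_range.1 hm; omega)
  calc ((List.range (L + 1)).map (List.length ∘ fun m => (List.range (2 ^ m)).map (natBits m))).sum
      ≤ (List.range (L + 1)).length * 2 ^ L := List.sum_le_card_nsmul _ _ (fun x hx => by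
          obtain ⟨m, hm, rfl⟩ := List.mem_map.1 hx; exact h m hm) |>.trans (by simp)
    _ = (L + 1) * 2 ^ L := by rw [List.length_range]
    _ ≤ 2 ^ L * 2 ^ L := Nat.mul_le_mul_right _ Nat.lt_two_pow_self
    _ = 4 ^ L := by rw [← mul_pow]; norm_num

/-! ### The list decoder -/

/-- The advice length `L(n, e) = c_A (⌊log₂(n+e)⌋ + 1)`. [cite: Hirahara2018, Thm. 4.7 / Cor. 4.8 (`O(log(n/ε))`)] -/
def advLen (cA n e : ℕ) : ℕ := cA * (Nat.log 2 (n + e) + 1)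

/-- **The list decoder**: on `(e, n, r)` the outputs of the advised decoder `decA` on
`⟨adv, ⟨1ᵉ, ⟨1ⁿ, r⟩⟩⟩` for all `adv ∈ advList L(n, e)`. [cite: Hirahara2018, Thm. 4.7] -/
def decList (decA : List Bool → List Bool) (cA : ℕ) (t : ℕ × ℕ × List Bool) : List (List Bool) :=
  (advList (advLen cA t.2.1 t.1)).map fun adv => decA (boolPair adv (boolPair (ones t.1) (boolPair (ones t.2.1) t.2.2)))

/-- The code of the decoder's input `(e, n, r) ↦ ⟨1ᵉ, ⟨1ⁿ, r⟩⟩`. [folklore] -/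
abbrev inE : ℕ × ℕ × List Bool → List Bool := pairE unE (pairE unE strE)

/-- The input code is `⟨1ᵉ, ⟨1ⁿ, r⟩⟩`. [folklore] -/
theorem inE_apply (e n : ℕ) (r : List Bool) : inE (e, n, r) = boolPair (ones e) (boolPair (ones n) r) := by
  simp [pairE_apply, unE_eq_ones, strE]

/-- `2^{⌊log₂ k⌋ + 1} ≤ 2 (k + 1)`. [folklore] -/
theorem two_pow_log_succ_le (k : ℕ) : 2 ^ (Nat.log 2 k + 1) ≤ 2 * (k + 1) := by
  rw [pow_succ]
  rcases Nat.eq_zero_or_pos k with rfl | hk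
  · simp
  · have := Nat.pow_log_le_self 2 hk.ne'
    omega

/-- **The list decoder is polynomial time** (typed `FP` algebra). [cite: AroraBarakCC2009, §1.3] -/
theorem decList_codeFP {decA : List Bool → List Bool} (hdecA : decA ∈ FP) (cA : ℕ) :
    CodeFP inE (rawE strE) (decList decA cA) := by
  -- `k = n + e` in unary, the advice length in binary and in unary
  have hk : CodeFP inE unE (fun t => t.2.1 + t.1) := unAdd.comp ((snd _ _).fst'.pair (fst _ _))
  have hlog : CodeFP inE natE (fun t => Nat.log 2 (t.2.1 + t.1)) :=
    (natLog2Min.comp ((natOfUn.comp hk).pair (replicateUnit.comp hk))).congr fun t => by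
      simp only [List.length_replicate, id]
      exact min_eq_right (Nat.log_le_self 2 _)
  have hL : CodeFP inE natE (fun t => advLen cA t.2.1 t.1) :=
    (natMul.comp ((const _ cA).pair (natAdd.comp (hlog.pair (const _ 1))))).congr fun _ => rfl
  have hcap : CodeFP inE unE (fun t => cA * (t.2.1 + t.1) + cA) :=
    unAdd.comp (((unMulConst cA).comp hk).pair (const _ cA))
  have hLu : CodeFP inE unE (fun t => advLen cA t.2.1 t.1) :=
    (unOfNatMin.comp (hcap.pair hL)).congr fun t => by
      refine min_eq_left ?_
      unfold advLen
      have := Nat.log_le_self 2 (t.2.1 + t.1)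
      nlinarith
  -- the budget list `((k + 1)·2)^{cA} ≥ 2^L` units
  have hB : CodeFP inE (rawE unitE) (fun t => List.replicate (((t.2.1 + t.1 + 1) * 2) ^ cA) ()) :=
    ((unitsPow cA).comp ((unMulConst 2).comp (unSucc.comp hk))).congr fun t => by ring_nf
  -- the lengths `m = 0, …, L`
  have hms : CodeFP inE (rawE natE) (fun t => List.range (advLen cA t.2.1 t.1 + 1)) :=
    urange.comp (unSucc.comp hLu)
  -- in the context `(t, m)`: `m` in unary (capped by `L`), `2^m`, the range below it, the numerals
  have hmU : CodeFP (pairE inE natE) unE (fun p => min p.2 (advLen cA p.1.2.1 p.1.1)) :=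
    unOfNatMin.comp ((hLu.comp (fst _ _)).pair (snd _ _))
  have hpow : CodeFP (pairE inE natE) natE (fun p => 2 ^ min p.2 (advLen cA p.1.2.1 p.1.1)) :=
    natPow.comp ((const _ 2).pair hmU)
  have hrng : CodeFP (pairE inE natE) (rawE natE)
      (fun p => List.range (min (2 ^ min p.2 (advLen cA p.1.2.1 p.1.1)) (((p.1.2.1 + p.1.1 + 1) * 2) ^ cA))) :=
    ((brange unitE).comp ((hB.comp (fst _ _)).pair hpow)).congr fun p => by simp
  have hbits : CodeFP (pairE unE natE) strE (fun p => natBits p.1 p.2) :=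
    of_fn (fstP ∘ padTakeFn) (comp_mem_FP fstP_mem_FP padTakeFn_mem_FP) fun p => by
      rw [pairE_apply, unE_eq_ones, Function.comp_apply, padTakeFn_boolPair, fstP_boolPair]
      simp only [ones, List.length_replicate, strE, id]
      rw [takeD_eq_natBits, bitsToNat_encodeNat]
  have hinner : CodeFP (pairE inE natE) (rawE strE)
      (fun p => (List.range (min (2 ^ min p.2 (advLen cA p.1.2.1 p.1.1)) (((p.1.2.1 + p.1.1 + 1) * 2) ^ cA))).map
        fun i => natBits (min p.2 (advLen cA p.1.2.1 p.1.1)) i) := by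
    have h := map (σ := (ℕ × ℕ × List Bool) × ℕ) (eσ := pairE inE natE) (eα := natE) (eβ := strE)
      (g := fun q => natBits (min q.1.2 (advLen cA q.1.1.2.1 q.1.1.1)) q.2) (hbits.comp ((hmU.comp (fst _ _)).pair (snd _ _)))
    exact (h.comp ((CodeFP.id _).pair hrng)).congr fun _ => rfl
  -- all advice strings: at `m ≤ L` the caps are invisible
  have hadv : CodeFP inE (rawE strE) (fun t => advList (advLen cA t.2.1 t.1)) := by
    have h := ((flatten strE).comp ((map hinner).comp ((CodeFP.id _).pair hms)))
    refine h.congr fun t => ?_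
    unfold advList
    congr 1
    refine List.map_congr_left fun m hm => ?_
    have hmL : m ≤ advLen cA t.2.1 t.1 := by have := List.mem_range.1 hm; omega
    have hcapB : 2 ^ m ≤ ((t.2.1 + t.1 + 1) * 2) ^ cA := by
      calc 2 ^ m ≤ 2 ^ advLen cA t.2.1 t.1 := Nat.pow_le_pow_right two_pos hmL
        _ = (2 ^ (Nat.log 2 (t.2.1 + t.1) + 1)) ^ cA := by rw [advLen, ← pow_mul, mul_comm]
        _ ≤ (2 * (t.2.1 + t.1 + 1)) ^ cA := Nat.pow_le_pow_left (two_pow_log_succ_le _) cA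
        _ = ((t.2.1 + t.1 + 1) * 2) ^ cA := by rw [mul_comm]
    dsimp only [id]
    rw [min_eq_left hmL, min_eq_left hcapB]
  -- the decoder on every advice string
  have hdec : CodeFP (pairE inE strE) strE
      (fun p => decA (boolPair p.2 (boolPair (ones p.1.1) (boolPair (ones p.1.2.1) p.1.2.2)))) :=
    (of_fn (eα := pairE strE inE) (eβ := strE) (g := fun q => decA (pairE strE inE q)) decA hdecA fun _ => rfl).comp
      ((snd _ _).pair (fst _ _)) |>.congr fun p => by simp [pairE_apply, unE_eq_ones]
  exact ((map hdec).comp ((CodeFP.id _).pair hadv)).congr fun _ => rfl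

/-- Field `i` of a coded list is its `i`-th element (twin of `FregeTransl.nthF_encList`,
`FregeTranslation.lean`, which sits on the proof-complexity development and is not imported here).
[folklore] -/
theorem nthF_encList : ∀ (i : ℕ) (l : List (List Bool)), nthF i (encList l) = l.getD i []
  | 0, [] => by simp [encList, fstF, boolUnpair]
  | 0, a :: l => by simp [encList]
  | i + 1, [] => by
    have : sndF [] = [] := by simp [sndF, boolUnpair]
    simp only [nthF, Function.comp_apply, encList_nil, this]
    simpa using nthF_encList i []
  | i + 1, a :: l => by simp [encList, nthF_encList i l]

/-- A member of a list is one of its fields. [folklore] -/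
theorem exists_getD_eq_of_mem {l : List (List Bool)} {x : List Bool} (h : x ∈ l) : ∃ i < l.length, l.getD i [] = x := by
  obtain ⟨i, hi, rfl⟩ := List.getElem_of_mem h
  exact ⟨i, hi, by rw [List.getD_eq_getElem _ _ hi]⟩

/-- `4^{c_A (⌊log₂ k⌋ + 1)} ≤ 4^{c_A} (k + 1)^{2 c_A}`. [folklore] -/
theorem four_pow_advLen_le (cA n e : ℕ) : 4 ^ advLen cA n e ≤ 4 ^ cA * (n + e + 1) ^ (2 * cA) := by
  have h2 := two_pow_log_succ_le (n + e)
  calc 4 ^ advLen cA n e = (2 ^ (Nat.log 2 (n + e) + 1)) ^ (2 * cA) := by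
        rw [advLen, show (4 : ℕ) = 2 ^ 2 by norm_num, ← pow_mul, ← pow_mul]; ring_nf
    _ ≤ (2 * (n + e + 1)) ^ (2 * cA) := Nat.pow_le_pow_left h2 _
    _ = 4 ^ cA * (n + e + 1) ^ (2 * cA) := by
        rw [mul_pow, pow_mul, show (2 : ℕ) ^ 2 = 4 by norm_num]

end CodeAdv

open CodeAdv

/-- **Thm. 4.7 in advice form gives the list-form code of `Hirahara2018_gapMINKT_mem_PromiseP_of_code`.**
Given `enc, decA ∈ FP` with block length `2^{ℓ(n,e)}`, `ℓ ≤ c_L(⌊log₂(n+e)⌋+1)`, such that every word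
`r` agreeing with `Enc(1ᵉ, x)` on `≥ (1/2 + 1/e) 2^ℓ` positions is decoded to `x` by `decA` under SOME
advice of length `≤ c_A(⌊log₂(n+e)⌋+1)` (read as `⟨adv, ⟨1ᵉ, ⟨1ⁿ, r⟩⟩⟩`), the list decoder that tries
all advice strings prints `x` within its first `4^{c_A}(n+e+1)^{2c_A}` fields.
[cite: Hirahara2018, Thm. 4.7 and Cor. 4.8] -/
theorem hcode_of_advice {enc decA : List Bool → List Bool} {ell : ℕ → ℕ → ℕ} {cL cA : ℕ}
    (henc : enc ∈ FP) (hdecA : decA ∈ FP) (hell : ∀ n e, ell n e ≤ cL * (Nat.log 2 (n + e) + 1))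
    (hlen : ∀ (n e : ℕ) (x : List Bool), x.length = n → (enc (boolPair (ones e) x)).length = 2 ^ ell n e)
    (hadv : ∀ (n e : ℕ) (x r : List Bool), x.length = n → 1 ≤ e → r.length = 2 ^ ell n e →
      (e + 2) * 2 ^ ell n e ≤ 2 * e * NWStr.agreeCount r (enc (boolPair (ones e) x)) →
      ∃ adv : List Bool, adv.length ≤ cA * (Nat.log 2 (n + e) + 1) ∧
        decA (boolPair adv (boolPair (ones e) (boolPair (ones n) r))) = x) :
    ∃ (enc dec : List Bool → List Bool) (ell : ℕ → ℕ → ℕ) (cL : ℕ) (pL : Polynomial ℕ),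
      enc ∈ FP ∧ dec ∈ FP ∧ (∀ n e, ell n e ≤ cL * (Nat.log 2 (n + e) + 1)) ∧
      (∀ (n e : ℕ) (x : List Bool), x.length = n → (enc (boolPair (ones e) x)).length = 2 ^ ell n e) ∧
      (∀ (n e : ℕ) (x r : List Bool), x.length = n → 1 ≤ e → r.length = 2 ^ ell n e →
        (e + 2) * 2 ^ ell n e ≤ 2 * e * NWStr.agreeCount r (enc (boolPair (ones e) x)) →
        ∃ i ≤ pL.eval (n + e), nthF i (dec (boolPair (ones e) (boolPair (ones n) r))) = x) := by
  obtain ⟨dec, hdecFP, hdec⟩ := decList_codeFP hdecA cA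
  refine ⟨enc, dec, ell, cL, Polynomial.C (4 ^ cA) * (X + 1) ^ (2 * cA), henc, hdecFP, hell, hlen,
    fun n e x r hx he hr hagree => ?_⟩
  obtain ⟨adv, hadvlen, hx'⟩ := hadv n e x r hx he hr hagree
  have hmem : x ∈ decList decA cA (e, n, r) := by
    unfold decList
    exact List.mem_map.2 ⟨adv, mem_advList hadvlen, hx'⟩
  obtain ⟨i, hi, hix⟩ := exists_getD_eq_of_mem hmem
  refine ⟨i, ?_, ?_⟩
  · have hl : (decList decA cA (e, n, r)).length ≤ 4 ^ cA * (n + e + 1) ^ (2 * cA) := by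
      unfold decList
      rw [List.length_map]
      exact (length_advList_le _).trans (four_pow_advLen_le cA n e)
    have : i < (Polynomial.C (4 ^ cA) * (X + 1) ^ (2 * cA)).eval (n + e) := by
      simp only [eval_mul, eval_C, eval_pow, eval_add, eval_X, eval_one]
      exact hi.trans_le hl
    exact this.le
  · have h := hdec (e, n, r)
    rw [inE_apply] at h
    have hid : (decList decA cA (e, n, r)).map strE = decList decA cA (e, n, r) := List.map_id _
    rw [h, rawE, hid, nthF_encList, hix]

/-- **Hirahara 2018, Cor. 4.23 from `[BFP05]` and a polynomial-time list-decodable code in advice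
form** (Thm. 4.7 as vendored by `ListDecodableCode.lean`): the decision route
`Hirahara2018_gapMINKT_mem_PromiseP_of_code` fed with `hcode_of_advice`.
[cite: Hirahara2018, Cor. 4.23 (proof), Thm. 4.7] -/
theorem Hirahara2018_gapMINKT_mem_PromiseP_of_adviceCode (hBPP : BuhrmanFortnowPavan2004_PromiseBPP'_subset_PromiseP)
    (hcodeA : ∃ (enc decA : List Bool → List Bool) (ell : ℕ → ℕ → ℕ) (cL cA : ℕ),
      enc ∈ FP ∧ decA ∈ FP ∧ (∀ n e, ell n e ≤ cL * (Nat.log 2 (n + e) + 1)) ∧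
      (∀ (n e : ℕ) (x : List Bool), x.length = n → (enc (boolPair (ones e) x)).length = 2 ^ ell n e) ∧
      (∀ (n e : ℕ) (x r : List Bool), x.length = n → 1 ≤ e → r.length = 2 ^ ell n e →
        (e + 2) * 2 ^ ell n e ≤ 2 * e * NWStr.agreeCount r (enc (boolPair (ones e) x)) →
        ∃ adv : List Bool, adv.length ≤ cA * (Nat.log 2 (n + e) + 1) ∧
          decA (boolPair adv (boolPair (ones e) (boolPair (ones n) r))) = x)) :
    Hirahara2018_gapMINKT_mem_PromiseP := by
  obtain ⟨enc, decA, ell, cL, cA, henc, hdecA, hell, hlen, hadv⟩ := hcodeA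
  exact Hirahara2018_gapMINKT_mem_PromiseP_of_code hBPP (hcode_of_advice henc hdecA hell hlen hadv)

end Literature.Computability.MetaComplexity

end
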